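import Literature.NumberTheory.GaloisRepresentations.IdeleClassBarSLayers
import Literature.NumberTheory.GaloisRepresentations.IdeleClassModUnitsSInvariantTower
import Literature.NumberTheory.GaloisRepresentations.RestrictedRamificationLayerIndexPPower
import Literature.Algebra.Homology.DiscreteRepLayerInvariantsPrimary
import Literature.Algebra.Homology.CoinducedConjugation
import Literature.GroupTheory.ProfiniteSubquotients
import HarnessLib

/-!
# THE invariant map of the `S`-idèle class formation: `inv_S : H²(G_S, C̄_S) = Ext²_{C_{G_S}}(ℤ, C̄_S) ↪ ℚ/ℤ`
# (Harari Def. 16.3 / Thm. 17.2; Milne ADT I §1, §4; NSW (8.3.9)–(8.3.10)), its injectivity, its range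
# `⋃_{E ⊂ K_S} (1/[E:K])ℤ/ℤ ⊇ ℚ/ℤ[p^∞]` (`S ⊇ S_p`), `p`-divisibility of `H²(G_S, C̄_S)` and `H¹(G_S, C̄_S) = 0`

Topic `NumberTheory/GaloisRepresentations`; namespace `Literature.NumberTheory.GaloisRepresentations.IdeleClassBar`.
Definitions with bodies (`layerInvS`, `invS`) and theorems; NO named fact, no `sorry`, no instance, no notation; number
fields in `Type`.  Sequel to bsd-line-x1-p1-w3's `IdeleClassBarSLayers` (the layers `V̄_E = Gal(K_S/E) ≤ G_S` of
`C̄_S = classBarSD K S`, cofinal; `layerSCohomologyIso S hE n : Hⁿ(G_S ⧸ V̄_E, C̄_S^{V̄_E}) ≅ Hⁿ(Gal(E/K), C_S(E))`;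
the transition on vectors is Harari's `C_S(E) → C_S(E')`), to `IdeleClassModUnitsSInvariant(Tower)` (this seat:
`inv_{E/K,S} = classModUnitsInv`, injective, range `{q : [E:K] • q = 0}`, `inv ∘ Inf = inv`), to door-c4's
`DiscreteRepLayerColimitDesc` (`LayerColimit.desc`) and to bsd-line-x1-p1-w7's `DiscreteRepLayerInvariantsPrimary`
(`exists_desc_eq_of_pow_nsmul_eq_zero`, `exists_eq_nsmul_of_layers`, `ext_one_eq_zero_of_layers`) and
`RestrictedRamificationLayerIndexPPower` (`p^∞ ∣ #G_S` along the layers when `S ⊇ S_p`).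

THE POINT.  Tate's «passage to the limit» (C–F VII §11.2 (bis)) for Harari's `P`-class formation `(G_S, C̄_S)` (Thm.
17.2): the layer invariants `inv_{E/K,S} : H²(Gal(E/K), C_S(E)) ⥲ (1/[E:K])ℤ/ℤ` (`E ⊂ K_S`) are compatible with the inflations
(§2: door-c4's `stepG` between the layers of `C̄_S` IS w4's `classModUnitsInf` under w3's layer isomorphisms, and
`inv ∘ Inf = inv`), hence descend to **`invS S : Ext²_{C_{G_S}}(ℤ, C̄_S) →+ ℚ/ℤ`** (§3), INJECTIVE, with range
`⋃_E (1/[E:K])ℤ/ℤ` — not all of `ℚ/ℤ`, but containing the `p`-power torsion when `S ⊇ S_p` (cyclotomic layers), so that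
`H²(G_S, C̄_S)` is `p`-divisible; and `H¹(G_S, C̄_S) = 0` (§4).  The same four facts at every open subgroup of `G_S` (the
engine's quantifier `U : OpenNormalSubgroup G_S`, via the relative layers and `inv_U ∘ Res = [G_S:U] · inv_S`) are the sequels.

Cell `bsd-eis`, background lane «PT-Ш-S-TC» of crux `GoodLatticeBDPValue` (stmt-BirchSwinnertonDyer-19032), brick D2-CF,
seat bsd-line-x1-p1-w5 g10.  HONEST FRAMING: classical class field theory in the tree's normalisation; no duality theorem,
no case of Poitou–Tate and no case of BSD is proved here.

## References
* D. Harari, *Galois Cohomology and Class Field Theory*, Universitext (2020), §16.1 Def. 16.3, §16.4 Remark 16.24 (b),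
  §17.1 Remark 17.1 and Thm. 17.2, §17.4 (17.1). [Harari2020]
* J. W. S. Cassels, A. Fröhlich (eds.), *Algebraic Number Theory* (1967), Ch. VII (J. Tate) §11.2 (bis) («passing to the
  limit»). [CasselsFrohlichANT1967]
* J. S. Milne, *Arithmetic Duality Theorems* (2nd ed. 2006), I §1 (class formations), I §4 (`(G_S, C_S)`). [MilneADT2006]
* J. Neukirch, A. Schmidt, K. Wingberg, *Cohomology of Number Fields* (2nd ed. 2008), VIII §3 (8.3.9)–(8.3.10).
  [NeukirchSchmidtWingberg2008]
* J.-P. Serre, *Galois Cohomology* (1997), I §2.2 Proposition 8. [SerreGaloisCohomology1997]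
-/

noncomputable section

open NumberField IsDedekindDomain CategoryTheory CategoryTheory.Limits groupCohomology
open Field (absoluteGaloisGroup)
open Literature.NumberTheory.Automorphic Literature.NumberTheory.Automorphic.IdeleClassGroup
open Literature.NumberTheory.NumberFields
open Literature.Algebra.Homology Literature.Algebra.Homology.DiscreteRep
open Literature.NumberTheory.GaloisRepresentations.LocalWeilDatum (galFixing)
open Literature.AnabelianGeometry.AbsoluteAnabelian.Prop121vii (zmodToQmodZ)
open scoped Classical

namespace Literature.NumberTheory.GaloisRepresentations

namespace IdeleClassBar

variable {K : Type} [Field K] [NumberField K] (S : Finset (HeightOneSpectrum (𝓞 K)))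

/-! ## §1. The layers inside `K_S` are unramified outside `S`; `G_S` is profinite -/

/-- A layer `E ⊆ K_S` is unramified outside `S` over `K` (w3's `isUnramifiedIn_of_insideKS`, in the binder shape `hS` of
the `classModUnits` files). [cite: NeukirchSchmidtWingberg2008, VIII §3] -/
theorem forall_isUnramifiedIn_of_insideKS {E : GalLayer K}
    (hE : ramificationSubgroup K (↑S : Set (HeightOneSpectrum (𝓞 K))) ≤ galFixing K E.1) :
    haveI := E.numberField
    ∀ v : HeightOneSpectrum (𝓞 K), v ∉ S → Algebra.IsUnramifiedIn (𝓞 E.1) v.asIdeal :=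
  fun _ hv => isUnramifiedIn_of_insideKS S hE hv

omit [NumberField K] in
/-- `G_S = Γ_K ⧸ N_S` is totally disconnected (`N_S` is closed). [cite: SerreGaloisCohomology1997, I §1.1] -/
theorem totallyDisconnectedSpace_GS [CharZero K] :
    TotallyDisconnectedSpace (GaloisGroupUnramifiedOutside K (↑S : Set (HeightOneSpectrum (𝓞 K)))) :=
  Literature.GroupTheory.ProfiniteSubquotients.totallyDisconnectedSpace_quotient
    (ramificationSubgroup K (↑S : Set (HeightOneSpectrum (𝓞 K)))) (ramificationSubgroup_isClosed K _)

/-! ## §2. The layer invariants `inv_{E/K,S} ∘ layerSCohomologyIso` and their compatibility with `stepG` -/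

/-- **The invariant map of the layer `C̄_S^{V̄_E}`**: `inv_{E/K,S} ∘ (H²(G_S ⧸ V̄_E, C̄_S^{V̄_E}) ≅ H²(Gal(E/K), C_S(E)))`.
[cite: Harari2020, §16.1 Def. 16.3, §17.1 Thm. 17.2][cite: CasselsFrohlichANT1967, Ch. VII §11.2 (bis)] -/
def layerInvS {E : GalLayer K} (hE : ramificationSubgroup K (↑S : Set (HeightOneSpectrum (𝓞 K))) ≤ galFixing K E.1) :
    groupCohomology (layerRepS S E) 2 →+ AddCircle (1 : ℚ) :=
  haveI := E.numberField
  haveI := E.isGalois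
  (IdeleCohomology.classModUnitsInv (F := K) (E := E.1) S (forall_isUnramifiedIn_of_insideKS S hE)).comp
    (layerSCohomologyIso S hE 2).hom.hom.toAddMonoidHom

/-- Formula: `layerInvS hE c = inv_{E/K,S} (iso_E c)`. [cite: Harari2020, §17.1 Thm. 17.2] -/
theorem layerInvS_apply {E : GalLayer K}
    (hE : ramificationSubgroup K (↑S : Set (HeightOneSpectrum (𝓞 K))) ≤ galFixing K E.1) (c : groupCohomology (layerRepS S E) 2) :
    layerInvS S hE c = (haveI := E.numberField; haveI := E.isGalois;
      IdeleCohomology.classModUnitsInv (F := K) (E := E.1) S (forall_isUnramifiedIn_of_insideKS S hE)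
        ((layerSCohomologyIso S hE 2).hom c)) := by
  rw [layerInvS, AddMonoidHom.coe_comp, Function.comp_apply, LinearMap.toAddMonoidHom_coe]

/-- `layerInvS hE (iso_E⁻¹ y) = inv_{E/K,S} y`. [cite: Harari2020, §17.1 Thm. 17.2] -/
theorem layerInvS_iso_inv {E : GalLayer K}
    (hE : ramificationSubgroup K (↑S : Set (HeightOneSpectrum (𝓞 K))) ≤ galFixing K E.1)
    (y : groupCohomology (haveI := E.numberField; IdeleCohomology.classModUnitsRep K E.1 S) 2) :
    layerInvS S hE ((layerSCohomologyIso S hE 2).inv y) = (haveI := E.numberField; haveI := E.isGalois;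
      IdeleCohomology.classModUnitsInv (F := K) (E := E.1) S (forall_isUnramifiedIn_of_insideKS S hE) y) := by
  rw [layerInvS_apply, ← ModuleCat.comp_apply, Iso.inv_hom_id, ModuleCat.id_apply]

/-- **`layerInvS hE` is injective** (`inv_{E/K,S}` is, and the layer isomorphism is an isomorphism).
[cite: Harari2020, §17.1 Thm. 17.2][cite: CasselsFrohlichANT1967, Ch. VII §11.2 (bis), Result] -/
theorem layerInvS_injective {E : GalLayer K}
    (hE : ramificationSubgroup K (↑S : Set (HeightOneSpectrum (𝓞 K))) ≤ galFixing K E.1) :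
    Function.Injective (layerInvS S hE) := by
  haveI := E.numberField
  haveI := E.isGalois
  intro c c' h
  rw [layerInvS_apply, layerInvS_apply] at h
  have h' := IdeleCohomology.classModUnitsInv_injective S _ h
  have := congrArg (layerSCohomologyIso S hE 2).inv h'
  rwa [← ModuleCat.comp_apply, ← ModuleCat.comp_apply, Iso.hom_inv_id, ModuleCat.id_apply, ModuleCat.id_apply] at this

/-- **The range of `layerInvS hE` is `{q : [E:K] • q = 0} = (1/[E:K])ℤ/ℤ`.**
[cite: Harari2020, §16.4 Remark 16.24 (b), §17.1 Thm. 17.2] -/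
theorem mem_range_layerInvS_iff {E : GalLayer K}
    (hE : ramificationSubgroup K (↑S : Set (HeightOneSpectrum (𝓞 K))) ≤ galFixing K E.1) (q : AddCircle (1 : ℚ)) :
    q ∈ Set.range (layerInvS S hE) ↔ Module.finrank K E.1 • q = 0 := by
  haveI := E.numberField
  haveI := E.isGalois
  rw [← IdeleCohomology.mem_range_classModUnitsInv_iff S (forall_isUnramifiedIn_of_insideKS S hE)]
  constructor
  · rintro ⟨c, rfl⟩
    exact ⟨_, (layerInvS_apply S hE c).symm⟩
  · rintro ⟨y, rfl⟩
    exact ⟨_, layerInvS_iso_inv S hE y⟩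

/-- **The group homomorphisms of the two inflations agree**: `(G_S⧸V̄_{E'} → G_S⧸V̄_E) ∘ quotLayerSEquiv_{E'}⁻¹ =
quotLayerSEquiv_E⁻¹ ∘ (σ ↦ σ|_E)` as maps `Gal(E'/K) → G_S ⧸ V̄_E` (both send `σ|_{E'}` to `[[σ]]`).
[cite: SerreGaloisCohomology1997, I §2.2 Proposition 8] -/
theorem quotMap_comp_quotLayerSEquiv_symm {E E' : GalLayer K} (h : E ≤ E')
    (hE : ramificationSubgroup K (↑S : Set (HeightOneSpectrum (𝓞 K))) ≤ galFixing K E.1)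
    (hE' : ramificationSubgroup K (↑S : Set (HeightOneSpectrum (𝓞 K))) ≤ galFixing K E'.1) :
    haveI := E.isGalois; letI := GalLayer.algebraOfLE h; haveI := GalLayer.isScalarTower_of_le h;
    (DiscreteRep.quotMap (layerSubgroupS S E : Subgroup (GaloisGroupUnramifiedOutside K (↑S : Set (HeightOneSpectrum (𝓞 K)))))
        (layerSubgroupS S E' : Subgroup (GaloisGroupUnramifiedOutside K (↑S : Set (HeightOneSpectrum (𝓞 K)))))
        (layerSubgroupS_anti S h)).comp (quotLayerSEquiv S hE').symm.toMonoidHom =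
      (quotLayerSEquiv S hE).symm.toMonoidHom.comp (AlgEquiv.restrictNormalHom (F := K) (K₁ := E'.1) E.1) := by
  haveI := E.isGalois
  haveI := E'.isGalois
  letI := GalLayer.algebraOfLE h
  haveI := GalLayer.isScalarTower_of_le h
  refine MonoidHom.ext fun τ => ?_
  obtain ⟨q, rfl⟩ := (quotLayerSEquiv S hE').surjective τ
  induction q using QuotientGroup.induction_on with
  | H u =>
    induction u using QuotientGroup.induction_on with
    | H σ =>
      rw [MonoidHom.comp_apply, MonoidHom.comp_apply, MulEquiv.coe_toMonoidHom, MulEquiv.coe_toMonoidHom,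
        MulEquiv.symm_apply_apply, MulEquiv.eq_symm_apply, quotLayerSEquiv_mk_mk]
      change quotLayerSEquiv S hE (QuotientGroup.mk (QuotientGroup.mk σ)) = _
      rw [quotLayerSEquiv_mk_mk]
      exact (GalLayer.restrictHom_restrictHom h σ).symm

set_option maxHeartbeats 800000 in
-- two `groupCohomology.map` composites compared through Mathlib's `map_comp` / the cell's `map_congr'`; the `ℤ`-instance
-- paths of the layer objects make the unification slow (as in `SUnitsRestrictedLayersTransitions.stepG_comp_layerCohomologyIso`)
/-- **`stepG (V̄_E) (V̄_{E'}) ≫ iso_{E'} = iso_E ≫ classModUnitsInf K E E' S n`**: door-c4's transition between the layers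
`C̄_S^{V̄_E} ⊆ C̄_S^{V̄_{E'}}` of `C̄_S` is, under w3's layer isomorphisms, the inflation `Hⁿ(Gal(E/K), C_S(E)) →
Hⁿ(Gal(E'/K), C_S(E'))` of Harari's direct system `C_S = lim→ C_S(E)` (w4's `classModUnitsInf`).
[cite: SerreGaloisCohomology1997, I §2.2 Proposition 8][cite: NeukirchSchmidtWingberg2008, VIII §3 (8.3.9)][cite: Harari2020, §17.4 (17.1)] -/
theorem stepG_comp_layerSCohomologyIso {E E' : GalLayer K} (h : E ≤ E')
    (hE : ramificationSubgroup K (↑S : Set (HeightOneSpectrum (𝓞 K))) ≤ galFixing K E.1)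
    (hE' : ramificationSubgroup K (↑S : Set (HeightOneSpectrum (𝓞 K))) ≤ galFixing K E'.1) (n : ℕ) :
    haveI := E.numberField; haveI := E'.numberField; haveI := E.isGalois; letI := GalLayer.algebraOfLE h;
    haveI := GalLayer.isScalarTower_of_le h;
    LayerColimit.stepG (layerSubgroupS S E) (layerSubgroupS S E') (layerSubgroupS_anti S h) (classBarSD K S) n ≫
        (layerSCohomologyIso S hE' n).hom =
      (layerSCohomologyIso S hE n).hom ≫ IdeleCohomology.classModUnitsInf K E.1 E'.1 S n := by
  haveI := E.numberField
  haveI := E'.numberField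
  haveI := E.isGalois
  haveI := E'.isGalois
  letI := GalLayer.algebraOfLE h
  haveI := GalLayer.isScalarTower_of_le h
  rw [layerSCohomologyIso, layerSCohomologyIso, groupCohomology.mapIso_hom, groupCohomology.mapIso_hom,
    IdeleCohomology.classModUnitsInf, ← groupCohomology.map_comp, ← groupCohomology.map_comp]
  refine Literature.Algebra.Homology.map_congr' (quotMap_comp_quotLayerSEquiv_symm S h hE hE') _ _ (fun z => ?_) n
  obtain ⟨x, rfl⟩ := toLayerS_surjective S hE z
  change layerSModuleEquiv S hE'
      ((DiscreteRep.invariantsStepIncl _ _ (layerSubgroupS_anti S h) (classBarSD K S)).hom (toLayerS S hE x)) =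
    (IdeleCohomology.classModUnitsInflHom K E.1 E'.1 S).hom (layerSModuleEquiv S hE (toLayerS S hE x))
  rw [layerSModuleEquiv_invariantsStepIncl S h hE hE', layerSModuleEquiv_toLayerS, π_transHom_eq_classModUnitsInflHom S h]

/-- Elementwise form of the square. [cite: SerreGaloisCohomology1997, I §2.2 Proposition 8][cite: Harari2020, §17.4 (17.1)] -/
theorem layerSCohomologyIso_hom_stepG {E E' : GalLayer K} (h : E ≤ E')
    (hE : ramificationSubgroup K (↑S : Set (HeightOneSpectrum (𝓞 K))) ≤ galFixing K E.1)
    (hE' : ramificationSubgroup K (↑S : Set (HeightOneSpectrum (𝓞 K))) ≤ galFixing K E'.1) (n : ℕ)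
    (c : groupCohomology (layerRepS S E) n) :
    haveI := E.numberField; haveI := E'.numberField; haveI := E.isGalois; letI := GalLayer.algebraOfLE h;
    haveI := GalLayer.isScalarTower_of_le h;
    (layerSCohomologyIso S hE' n).hom
        (LayerColimit.stepG (layerSubgroupS S E) (layerSubgroupS S E') (layerSubgroupS_anti S h) (classBarSD K S) n c) =
      IdeleCohomology.classModUnitsInf K E.1 E'.1 S n ((layerSCohomologyIso S hE n).hom c) := by
  have hsq := congrArg (fun φ => φ c) (stepG_comp_layerSCohomologyIso S h hE hE' n)
  simpa only [ModuleCat.comp_apply] using hsq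

/-- **Compatibility of the layer invariants with door-c4's transitions**: `layerInvS hE' (stepG c) = layerInvS hE c` for
`E ≤ E'` inside `K_S` (`inv_{E'/K,S} ∘ Inf = inv_{E/K,S}`, this seat's `classModUnitsInv_classModUnitsInf`).
[cite: CasselsFrohlichANT1967, Ch. VII §11.2 (bis)][cite: Harari2020, §16.1 Def. 16.3] -/
theorem layerInvS_stepG {E E' : GalLayer K} (h : E ≤ E')
    (hE : ramificationSubgroup K (↑S : Set (HeightOneSpectrum (𝓞 K))) ≤ galFixing K E.1)
    (hE' : ramificationSubgroup K (↑S : Set (HeightOneSpectrum (𝓞 K))) ≤ galFixing K E'.1)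
    (c : groupCohomology (layerRepS S E) 2) :
    layerInvS S hE' (LayerColimit.stepG (layerSubgroupS S E) (layerSubgroupS S E') (layerSubgroupS_anti S h)
        (classBarSD K S) 2 c) = layerInvS S hE c := by
  haveI := E.numberField
  haveI := E'.numberField
  haveI := E.isGalois
  haveI := E'.isGalois
  letI := GalLayer.algebraOfLE h
  haveI := GalLayer.isScalarTower_of_le h
  rw [layerInvS_apply, layerInvS_apply, layerSCohomologyIso_hom_stepG S h hE hE' 2 c]
  exact IdeleCohomology.classModUnitsInv_classModUnitsInf S (forall_isUnramifiedIn_of_insideKS S hE)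
    (forall_isUnramifiedIn_of_insideKS S hE') _

/-! ## §3. THE invariant map `inv_S : Ext²_{C_{G_S}}(ℤ, C̄_S) →+ ℚ/ℤ` -/

/-- **The index set of the layers of `C̄_S`**: the finite Galois `E/K` inside `K_S`. [cite: NeukirchSchmidtWingberg2008, VIII §3] -/
abbrev LayerKS : Type :=
  {E : GalLayer K // ramificationSubgroup K (↑S : Set (HeightOneSpectrum (𝓞 K))) ≤ galFixing K E.1}

/-- Comparison of layer subgroups detects the order of the layers: `V̄_{E'} ≤ V̄_E` with `E ⊆ K_S` gives `E ≤ E'`.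
[cite: SerreGaloisCohomology1997, I §2.2 Proposition 8] -/
theorem le_of_layerSubgroupS_le {E E' : GalLayer K}
    (hE : ramificationSubgroup K (↑S : Set (HeightOneSpectrum (𝓞 K))) ≤ galFixing K E.1)
    (h : (layerSubgroupS S E' : Subgroup (GaloisGroupUnramifiedOutside K (↑S : Set (HeightOneSpectrum (𝓞 K))))) ≤
      layerSubgroupS S E) : E ≤ E' := by
  refine GalLayer.openNormalSubgroup_le_iff.1 fun σ hσ => ?_
  have hσ' : σ ∈ galFixing K E'.1 := hσ
  obtain ⟨τ, hτ, hτσ⟩ := (mem_layerSubgroupS_iff S E _).1 (h (mk_mem_layerSubgroupS S E' hσ'))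
  have h1 : τ⁻¹ * σ ∈ ramificationSubgroup K (↑S : Set (HeightOneSpectrum (𝓞 K))) := QuotientGroup.eq.1 hτσ
  have h2 : τ⁻¹ * σ ∈ galFixing K E.1 := hE h1
  have h3 : σ ∈ galFixing K E.1 := by simpa using (galFixing K E.1).mul_mem hτ h2
  exact h3

/-- **The layer invariants form a compatible family on the cofinal family `E ↦ V̄_E` (`E ⊂ K_S`) of open normal subgroups
of `G_S`** (w3's `exists_layerSubgroupS_le`; compatibility `layerInvS_stepG`).
[cite: CasselsFrohlichANT1967, Ch. VII §11.2 (bis)][cite: SerreGaloisCohomology1997, I §2.2 Proposition 8] -/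
theorem isCompatibleFamily_layerInvS [CompactSpace (GaloisGroupUnramifiedOutside K (↑S : Set (HeightOneSpectrum (𝓞 K))))]
    [TotallyDisconnectedSpace (GaloisGroupUnramifiedOutside K (↑S : Set (HeightOneSpectrum (𝓞 K))))] :
    LayerColimit.IsCompatibleFamily (fun E : LayerKS S => layerSubgroupS S E.1) (classBarSD K S) 2
      (fun E => layerInvS S E.2) := by
  refine ⟨fun W => ?_, fun E E' h c => ?_⟩
  · obtain ⟨E, hE, hEW⟩ := exists_layerSubgroupS_le S W
    exact ⟨⟨E, hE⟩, hEW⟩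
  · exact layerInvS_stepG S (le_of_layerSubgroupS_le S E.2 h) E.2 E'.2 c

/-- **THE invariant map of the `S`-idèle class formation, `inv_S : H²(G_S, C̄_S) = Ext²_{C_{G_S}}(ℤ, C̄_S) →+ ℚ/ℤ`** — the
descent to door-c4's colimit of the compatible family of layer invariants `inv_{E/K,S}` (Tate's passage to the limit, for
Harari's `P`-class formation `(G_S, C_S)`).
[cite: Harari2020, §16.1 Def. 16.3, §17.1 Thm. 17.2][cite: CasselsFrohlichANT1967, Ch. VII §11.2 (bis)][cite: MilneADT2006, I §4] -/
def invS : Abelian.Ext (triv (k := ℤ) (Γ := GaloisGroupUnramifiedOutside K (↑S : Set (HeightOneSpectrum (𝓞 K)))) ℤ)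
    (classBarSD K S) 2 →+ AddCircle (1 : ℚ) :=
  haveI := totallyDisconnectedSpace_GS S
  LayerColimit.desc (fun E : LayerKS S => layerSubgroupS S E.1) (classBarSD K S) 2 (fun E => layerInvS S E.2)
    (isCompatibleFamily_layerInvS S)

/-- **`inv_S (Inf_E c) = inv_{E/K,S} (iso_E c)`** on a class inflated from the layer `E ⊂ K_S`.
[cite: CasselsFrohlichANT1967, Ch. VII §11.2 (bis)][cite: Harari2020, §16.1 Def. 16.3] -/
theorem invS_inflG {E : GalLayer K} (hE : ramificationSubgroup K (↑S : Set (HeightOneSpectrum (𝓞 K))) ≤ galFixing K E.1)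
    (c : groupCohomology (layerRepS S E) 2) :
    (haveI := totallyDisconnectedSpace_GS S; invS S (LayerColimit.inflG (layerSubgroupS S E) (classBarSD K S) 2 c)) =
      layerInvS S hE c :=
  haveI := totallyDisconnectedSpace_GS S
  LayerColimit.desc_inflG (isCompatibleFamily_layerInvS S) ⟨E, hE⟩ c

/-- **Uniqueness**: an additive map `Ext²_{C_{G_S}}(ℤ, C̄_S) → ℚ/ℤ` agreeing with `inv_{E/K,S}` on every layer is `inv_S`.
[cite: Harari2020, §16.1 Def. 16.3] -/
theorem eq_invS_of_forall_inflG
    (g : Abelian.Ext (triv (k := ℤ) (Γ := GaloisGroupUnramifiedOutside K (↑S : Set (HeightOneSpectrum (𝓞 K)))) ℤ)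
      (classBarSD K S) 2 →+ AddCircle (1 : ℚ))
    (hg : ∀ (E : GalLayer K) (hE : ramificationSubgroup K (↑S : Set (HeightOneSpectrum (𝓞 K))) ≤ galFixing K E.1)
      (c : groupCohomology (layerRepS S E) 2),
      (haveI := totallyDisconnectedSpace_GS S; g (LayerColimit.inflG (layerSubgroupS S E) (classBarSD K S) 2 c)) =
        layerInvS S hE c) :
    g = invS S :=
  haveI := totallyDisconnectedSpace_GS S
  LayerColimit.eq_desc_of_forall_inflG (isCompatibleFamily_layerInvS S) g fun E c => hg E.1 E.2 c

/-- **`inv_S` is injective** (each `inv_{E/K,S}` is) — the field `invAt_injective` at `U = ⊤`.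
[cite: Harari2020, §17.1 Thm. 17.2][cite: CasselsFrohlichANT1967, Ch. VII §11.2 (bis), Result] -/
theorem invS_injective : Function.Injective (invS S) :=
  haveI := totallyDisconnectedSpace_GS S
  LayerColimit.desc_injective (isCompatibleFamily_layerInvS S) fun E => layerInvS_injective S E.2

/-- `inv_S x = 0 ↔ x = 0`. [cite: Harari2020, §17.1 Thm. 17.2] -/
theorem invS_eq_zero_iff
    (x : Abelian.Ext (triv (k := ℤ) (Γ := GaloisGroupUnramifiedOutside K (↑S : Set (HeightOneSpectrum (𝓞 K)))) ℤ)
      (classBarSD K S) 2) : invS S x = 0 ↔ x = 0 :=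
  ⟨fun h => invS_injective S (h.trans (map_zero _).symm), fun h => by rw [h, map_zero]⟩

/-! ## §4. The range of `inv_S`: the index of the layers, `p`-power torsion, `p`-divisibility, and `H¹ = 0` -/

/-- **`[G_S : V̄_E] = [E:K]`** (`G_S ⧸ V̄_E ≃* Gal(E/K)`). [cite: NeukirchSchmidtWingberg2008, VIII §3] -/
theorem index_layerSubgroupS {E : GalLayer K}
    (hE : ramificationSubgroup K (↑S : Set (HeightOneSpectrum (𝓞 K))) ≤ galFixing K E.1) :
    (layerSubgroupS S E : Subgroup (GaloisGroupUnramifiedOutside K (↑S : Set (HeightOneSpectrum (𝓞 K))))).index =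
      Module.finrank K E.1 := by
  haveI := E.finiteDimensional
  haveI := E.isGalois
  rw [Subgroup.index_eq_card, Nat.card_congr (quotLayerSEquiv S hE).toEquiv, IsGalois.card_aut_eq_finrank]

/-- **The range of `inv_S` on the layer `E` is `{q : [G_S : V̄_E] • q = 0}`** (the `hrange` hypothesis of w7's engine lemmas).
[cite: Harari2020, §16.4 Remark 16.24 (b)] -/
theorem mem_range_layerInvS_iff_index (E : LayerKS S) (q : AddCircle (1 : ℚ)) :
    q ∈ Set.range (layerInvS S E.2) ↔
      (layerSubgroupS S E.1 : Subgroup (GaloisGroupUnramifiedOutside K (↑S : Set (HeightOneSpectrum (𝓞 K))))).index • q = 0 := by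
  rw [index_layerSubgroupS S E.2]
  exact mem_range_layerInvS_iff S E.2 q

/-- **Every value of `inv_S` is killed by the degree of some layer**: `inv_S x ∈ (1/[E:K])ℤ/ℤ` for some `E ⊂ K_S` — the range of
`inv_S` is `⋃_E (1/[E:K])ℤ/ℤ` (NOT all of `ℚ/ℤ`: `(G_S, C_S)` is a `P`-class formation).
[cite: Harari2020, §16.4 Remark 16.24 (b), §17.1 Remark 17.1] -/
theorem exists_finrank_nsmul_invS_eq_zero
    (x : Abelian.Ext (triv (k := ℤ) (Γ := GaloisGroupUnramifiedOutside K (↑S : Set (HeightOneSpectrum (𝓞 K)))) ℤ)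
      (classBarSD K S) 2) :
    ∃ (E : GalLayer K), ramificationSubgroup K (↑S : Set (HeightOneSpectrum (𝓞 K))) ≤ galFixing K E.1 ∧
      Module.finrank K E.1 • invS S x = 0 := by
  haveI := totallyDisconnectedSpace_GS S
  obtain ⟨E, c, rfl⟩ := (isCompatibleFamily_layerInvS S).exists_inflG_eq x
  refine ⟨E.1, E.2, ?_⟩
  rw [invS_inflG S E.2]
  exact (mem_range_layerInvS_iff S E.2 _).1 ⟨c, rfl⟩

/-- **`p^∞ ∣ #G_S` along the layers** when `S ⊇ S_p`: for every `a` some layer `E ⊂ K_S` has `p^a ∣ [G_S : V̄_E] = [E:K]`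
(the cyclotomic layers; w7's `exists_insideKS_le_pow_dvd_relindex` at `W = ⊤`).
[cite: Harari2020, §17.1 Remark 17.1][cite: NeukirchSchmidtWingberg2008, VIII §3 (8.3.11) (proof)] -/
theorem exists_pow_dvd_index_layerSubgroupS {p : ℕ} [Fact p.Prime]
    (hSp : ∀ v : HeightOneSpectrum (𝓞 K), ((p : ℕ) : 𝓞 K) ∈ v.asIdeal → v ∈ (↑S : Set (HeightOneSpectrum (𝓞 K)))) (a : ℕ) :
    ∃ E : LayerKS S,
      p ^ a ∣ (layerSubgroupS S E.1 : Subgroup (GaloisGroupUnramifiedOutside K (↑S : Set (HeightOneSpectrum (𝓞 K))))).index := by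
  obtain ⟨E, hE, -, hdvd⟩ := OpenSubgroupLayer.exists_insideKS_le_pow_dvd_relindex (↑S : Set (HeightOneSpectrum (𝓞 K))) p hSp
    ⊤ isOpen_univ a
  refine ⟨⟨E, hE⟩, ?_⟩
  rwa [Subgroup.relIndex_top_right] at hdvd

/-- **The `p`-power torsion of `ℚ/ℤ` is in the range of `inv_S`** when `S ⊇ S_p` — the field `exists_invAt_eq` at `U = ⊤`
(w7's `exists_desc_eq_of_pow_nsmul_eq_zero`). [cite: Harari2020, §16.4 Remark 16.24 (b), §17.1 Remark 17.1][cite: MilneADT2006, I §4] -/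
theorem exists_invS_eq_of_pow_nsmul_eq_zero {p : ℕ} [Fact p.Prime]
    (hSp : ∀ v : HeightOneSpectrum (𝓞 K), ((p : ℕ) : 𝓞 K) ∈ v.asIdeal → v ∈ (↑S : Set (HeightOneSpectrum (𝓞 K))))
    (a : ℕ) (q : AddCircle (1 : ℚ)) (hq : p ^ a • q = 0) : ∃ x, invS S x = q := by
  haveI := totallyDisconnectedSpace_GS S
  exact exists_desc_eq_of_pow_nsmul_eq_zero (fun E : LayerKS S => layerSubgroupS S E.1) (classBarSD K S)
    (fun E => layerInvS S E.2) (isCompatibleFamily_layerInvS S)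
    (fun E q hq => (mem_range_layerInvS_iff_index S E q).2 hq) (exists_pow_dvd_index_layerSubgroupS S hSp) a q hq

/-- **`H²(G_S, C̄_S) = Ext²_{C_{G_S}}(ℤ, C̄_S)` is `p`-divisible** when `S ⊇ S_p` — the field `ext_triv_divisible` (`r = 2`) at
`U = ⊤` (w7's `exists_eq_nsmul_of_layers`: `x = Inf_E c`, `inv c = a/[E:K]`, and `a/(p[E:K])` is an invariant at a deeper layer).
[cite: Harari2020, §16.4 Remark 16.24 (b)][cite: MilneADT2006, I §1 and §4] -/
theorem exists_eq_nsmul_invS {p : ℕ} [Fact p.Prime]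
    (hSp : ∀ v : HeightOneSpectrum (𝓞 K), ((p : ℕ) : 𝓞 K) ∈ v.asIdeal → v ∈ (↑S : Set (HeightOneSpectrum (𝓞 K))))
    (x : Abelian.Ext (triv (k := ℤ) (Γ := GaloisGroupUnramifiedOutside K (↑S : Set (HeightOneSpectrum (𝓞 K)))) ℤ)
      (classBarSD K S) 2) : ∃ y, x = p • y := by
  haveI := totallyDisconnectedSpace_GS S
  exact exists_eq_nsmul_of_layers (fun E : LayerKS S => layerSubgroupS S E.1) (classBarSD K S)
    (fun E => layerInvS S E.2) (Fact.out : p.Prime) (isCompatibleFamily_layerInvS S) (fun E => layerInvS_injective S E.2)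
    (fun E q => mem_range_layerInvS_iff_index S E q) (exists_pow_dvd_index_layerSubgroupS S hSp) x

/-- **`H¹(G_S ⧸ V̄_E, C̄_S^{V̄_E}) = 0` on every layer** (`≅ H¹(Gal(E/K), C_S(E)) = 0`, w4 g16's `isZero_H1_res_classModUnits`
at `U = ⊤` through `H¹(Gal(E/K), C_E) ≅ H¹(Gal(E/K), C_S(E))`). [cite: Harari2020, §17.1 Thm. 17.2 (proof)][cite: MilneADT2006, I §4] -/
theorem layer_H1_eq_zero {E : GalLayer K}
    (hE : ramificationSubgroup K (↑S : Set (HeightOneSpectrum (𝓞 K))) ≤ galFixing K E.1)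
    (c : groupCohomology (layerRepS S E) 1) : c = 0 := by
  haveI := E.numberField
  haveI := E.isGalois
  have h0 : IsZero (groupCohomology (IdeleClassGroup.galoisRep K E.1) 1) := IdeleClassGroup.isZero_H1_galoisRep (F := K) (E := E.1)
  have h1 : IsZero (groupCohomology (IdeleCohomology.classModUnitsRep K E.1 S) 1) :=
    h0.of_iso (IdeleCohomology.groupCohomologyClassModUnitsIsoTop S (forall_isUnramifiedIn_of_insideKS S hE) 1).symm
  have h2 : IsZero (groupCohomology (layerRepS S E) 1) := h1.of_iso (layerSCohomologyIso S hE 1)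
  haveI := ModuleCat.subsingleton_of_isZero h2
  exact Subsingleton.elim _ _

/-- **`H¹(G_S, C̄_S) = Ext¹_{C_{G_S}}(ℤ, C̄_S) = 0`** — the field `ext_one_eq_zero` at `U = ⊤` (w7's `ext_one_eq_zero_of_layers`).
[cite: Harari2020, §16.1 Def. 16.1, §17.1 Thm. 17.2][cite: MilneADT2006, I §4] -/
theorem ext_one_eq_zero_classBarSD
    (x : Abelian.Ext (triv (k := ℤ) (Γ := GaloisGroupUnramifiedOutside K (↑S : Set (HeightOneSpectrum (𝓞 K)))) ℤ)
      (classBarSD K S) 1) : x = 0 := by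
  haveI := totallyDisconnectedSpace_GS S
  refine ext_one_eq_zero_of_layers (fun E : LayerKS S => layerSubgroupS S E.1) (classBarSD K S)
    (fun W => ?_) (fun E c => layer_H1_eq_zero S E.2 c) x
  obtain ⟨E, hE, hEW⟩ := exists_layerSubgroupS_le S W
  exact ⟨⟨E, hE⟩, hEW⟩

end IdeleClassBar

end Literature.NumberTheory.GaloisRepresentations

end
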